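import Literature.AnabelianGeometry.EtaleTheta.ThetaKummerInversionInnerLiftsNoGo
import HarnessLib

/-!
# NO vertex-`0` inner lift of the STAGE-2 inversion carries the FUNCTION-level [EtTh] Prop 1.4 (ii) package — EVERY
# Tate pair `(i, j)`, EVERY `p`: the half-twisted fixed sections over `G_{K_8}` (proof-only)

S. Mochizuki, *The étale theta function …*, Publ. RIMS **45** (2009) [EtTh]: Prop 1.4 (ii) p. 22 («`Θ̈(Ü⁻¹) = −Θ̈(Ü)`»),
§2 p. 36 (the inversion); *Inter-universal Teichmüller theory II*, Rmk 1.4.1 (ii) p. 28 (the inversion is a `Δ^tp_Ÿ`-outer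
automorphism over `G_k`). Classical here. [cite: MochizukiEtTh2009, Prop 1.4 (ii) p.22]

abc-iut cell, layer L2, seat abc-iut-w5-d125 (gen 8); PROOF-ONLY (NO definition, NO `Prop` fact, NO instance; D-0067). Part 3
of the row «P14ii-FN-PACKAGE» (abc-iut-L2-lead R687): sequel of `ThetaKummerInversionInnerLiftsNoGo.lean` (p469482: `modelχ`,
and the Tate instance `modelχq p 1 2` for `p ≡ 1 (mod 4)` via abc-iut-w5-d140's p454176). THIS FILE removes both restrictions at
stage 2 — every `ThetaSetting.modelχq p i j hj` (abc-iut-w5-d249 / abc-iut-L6-d6, R78 stage 2 «Tate shear»), every prime `p`: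

* `SettingModel.left_bTwist_inversionχq` — for `x = ⟨b^t, σ⟩` on the cusp axis: `(Ad(inl b^z) ∘ ι_χq)(x) =
  ⟨b^{z · t⁻¹ · κ_p(σ)^{j−2i} · (χ(σ)z)⁻¹}, σ⟩` (abc-iut-w5-d249's `tateInversion_left`, `invDefect_tatePairHom`,
  `affTwist₃Gfp_bPowGfp`), so `x` is FIXED iff `t² = κ_p(σ)^{j−2i} · z/χ(σ)z`;
* **`SettingModel.not_exists_package_modelχq_bAxisLift_of_constCompat`** — for every `z ∈ Ẑ` and every `ι'` agreeing
  pointwise with `Ad(inl b^z) ∘ ι_χq`: NO package `{hιFn, hΛ, hιθ}` for any `T` with `ConstCompat kummerDataχq`. Fixed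
  subgroup (no global cocycle, no rational `√−1`): `H₀ := {x : ι' x = x} ⊓ (b^Ẑ ⋊ G) ⊓ aug⁻¹(G_{K_8})`; on `G_{K_8}` one has
  `χ ≡ 1 (mod 8)` and `κ_p ∈ 4Ẑ` (`mem_GKNq_iff`: `K_8 ∋ ζ_8, q_X^{1/8} = p^{1/4}`), so `κ_p^{j−2i} · z/χ(σ)z = s⁴` is a
  fourth power: the fixed element over `σ` EXISTS (`t := s²`) and has EVEN `t`, i.e. lies in `Π^tp_Ÿ`; Galois image `G_{K_8}`,
  `K_8/ℚ_p` finite ⇒ this seat's `KummerCore.not_exists_package_of_constCompat_of_fixed`;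
* **`SettingModel.not_exists_package_modelχq_innerLift_of_constCompat_all`** — every vertex-`0` inner lift
  `Ad(inl γ) ∘ ι_χq`, `inl γ ∈ Π^tp_Y`, injective `Λ(Fn) → Δ_Θ`, `ConstCompat kummerDataχq`: NO package (transport along
  `inl(b^{ŷ γ}·γ⁻¹) ∈ Δ^tp_Ÿ`, p469482 §1, to the `b`-axis lift).

CENSUS SENTENCE (model design, numbers not a side): the Tate shear does not help — at EVERY stage-2 model of the tree the
function-level package with genuine constants is unsatisfiable for every vertex-`0` `Δ^tp_Y`-inner lift of the inversion
of record (the shear only adds a `b`-direction cocycle to the section twist; half-twisted fixed sections persist over `G_{K_8}`).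
HONEST FRAMING: classical group theory over the cell's typed interface and its SEMI-SYNTHETIC stage-2 model (consistency
evidence only); nothing disputed is asserted; no side is taken on [IUTchIII] Cor 3.12; typed ≠ proved.
-/

noncomputable section

namespace Literature.AnabelianGeometry.EtaleTheta.SettingModel

open Literature.AnabelianGeometry.SemiGraphs
open Literature.AnabelianGeometry.AbsoluteAnabelian (ZHatCompletion.mul_comm
  ZHatCompletion.exists_continuousMulEquiv_padicProd)
open _root_.Function

variable (p : ℕ) [Fact p.Prime] (i j : ℤ)

/-! ### §0. Commutative bookkeeping in `Ẑ` -/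

/-- `t·(z·(t⁻¹·d)·c⁻¹) = d·(z·c⁻¹)` in `Ẑ`. [cite: RibesZalesskii2010, Thm 2.7.1] -/
private theorem zh_id₁ (t z d c : ZH) : t * (z * (t⁻¹ * d) * c⁻¹) = d * (z * c⁻¹) := by
  obtain ⟨e, -⟩ := ZHatCompletion.exists_continuousMulEquiv_padicProd
  apply e.injective
  simp only [map_mul, map_inv]
  apply Multiplicative.toAdd.injective
  simp only [toAdd_mul, toAdd_inv]
  abel

/-- `z·(t⁻¹·d)·c⁻¹ = t⁻¹·(d·(z·c⁻¹))` in `Ẑ`. [cite: RibesZalesskii2010, Thm 2.7.1] -/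
private theorem zh_id₂ (t z d c : ZH) : z * (t⁻¹ * d) * c⁻¹ = t⁻¹ * (d * (z * c⁻¹)) := by
  obtain ⟨e, -⟩ := ZHatCompletion.exists_continuousMulEquiv_padicProd
  apply e.injective
  simp only [map_mul, map_inv]
  apply Multiplicative.toAdd.injective
  simp only [toAdd_mul, toAdd_inv]
  abel

/-- `(u⁴)^m = (u^m)⁴`. [cite: RibesZalesskii2010, Thm 2.7.1] -/
private theorem pow_four_zpow (u : ZH) (m : ℤ) : (u ^ (4 : ℕ)) ^ m = (u ^ m) ^ (4 : ℕ) := by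
  rw [← zpow_natCast, ← zpow_mul, mul_comm, zpow_mul, zpow_natCast]

/-- Square roots are unique in `Ẑ`: `t² = s² ⇒ t = s`. [cite: RibesZalesskii2010, Thm 2.7.1] -/
private theorem eq_of_sq_eq {t s : ZH} (h : t ^ 2 = s ^ 2) : t = s := sqHom_injective h

/-- **On `G_{K_8}` the fixed-point datum is a FOURTH POWER**: for `σ ∈ G_{K_8}` (`χ(σ) ≡ 1 (mod 8)`, `κ_p(σ)² ∈ 8Ẑ`),
`κ_p(σ)^m · z/χ(σ)z = s⁴` for some `s`. [cite: MochizukiEtTh2009, §1 p.13] -/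
theorem exists_pow_four_eq_of_mem_GK8 (m : ℤ) (z : ZH) {σ : GQp p}
    (hσ : σ ∈ (fieldKN (⊥ : IntermediateField ℚ_[p] (PadicAlgCl p)) (qModel p) 8).fixingSubgroup) :
    ∃ s : ZH, s ^ (4 : ℕ) = kappaP p σ ^ m * (z * (chi p σ z)⁻¹) := by
  obtain ⟨-, hκ⟩ := (mem_GKNq_iff p σ 8).mp hσ
  obtain ⟨u, hu⟩ := (ZHatLevel.level_eq_one_iff_exists_pow 8 _).mp hκ
  have hκ4 : kappaP p σ = u ^ (4 : ℕ) := by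
    apply eq_of_sq_eq
    rw [← hu, ← pow_mul]
    rfl
  have hc : ZHatLevel.level 8 (z * (chi p σ z)⁻¹) = 1 := by
    rw [map_mul, map_inv, level_chi_apply_of_mem_fixingSubgroup_fieldKN p 8 hσ z, mul_inv_cancel]
  obtain ⟨w, hw⟩ := (ZHatLevel.level_eq_one_iff_exists_pow 8 _).mp hc
  refine ⟨u ^ m * w ^ (2 : ℕ), ?_⟩
  have hcomm : Commute (u ^ m) (w ^ (2 : ℕ)) := ZHatCompletion.mul_comm _ _
  rw [hcomm.mul_pow, ← pow_four_zpow, ← hκ4, ← pow_mul, ← hw]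
  rfl

/-! ### §1. The `b`-axis elements under `Ad(inl b^z) ∘ ι_χq` -/

/-- **`(Ad(inl b^z) ∘ ι_χq)⟨b^t, σ⟩ = ⟨b^{z·t⁻¹·κ_p(σ)^{j−2i}·(χ(σ)z)⁻¹}, σ⟩`** (the stage-2 inversion inverts the axis
and adds the defect cocycle; conjugation by `b^z` adds the `χ`-coboundary of `z`). [cite: Mochizuki2012, Rmk 1.4.1 (ii) p.28] -/
theorem left_bTwist_inversionχq (z t : ZH) (x : PiTpχq p i j) (hx : x.left = bPowGfp t) :
    ((SemidirectProduct.inl (bPowGfp z) : PiTpχq p i j) * inversionχq p i j x *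
        (SemidirectProduct.inl (bPowGfp z))⁻¹).left =
      bPowGfp (z * (t⁻¹ * kappaP p x.right ^ (-i + -i + j)) * (chi p x.right z)⁻¹) := by
  rw [SemidirectProduct.mul_left, SemidirectProduct.mul_left, SemidirectProduct.left_inl, SemidirectProduct.right_inl,
    map_one, MulAut.one_apply, SemidirectProduct.mul_right, SemidirectProduct.right_inl, one_mul, inversionχq_apply,
    tateInversion_left, tateInversion_right, hx, gfpInv_bPowGfp_eq, invDefect_tatePairHom, ← map_inv,
    SemidirectProduct.left_inl, ← map_inv, actχq_apply, affTwist₃Gfp_bPowGfp, ← map_mul, ← map_mul, ← map_mul, map_inv]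

/-- … and its `G`-component is `σ`. [cite: Mochizuki2012, Rmk 1.4.1 (ii) p.28] -/
theorem right_bTwist_inversionχq (z : ZH) (x : PiTpχq p i j) :
    ((SemidirectProduct.inl (bPowGfp z) : PiTpχq p i j) * inversionχq p i j x *
        (SemidirectProduct.inl (bPowGfp z))⁻¹).right = x.right := by
  rw [SemidirectProduct.mul_right, SemidirectProduct.mul_right, SemidirectProduct.right_inl, one_mul, ← map_inv,
    SemidirectProduct.right_inl, mul_one, inversionχq_apply, tateInversion_right]

/-- The `b`-twisted stage-2 lifts `Ad(inl b^z) ∘ ι_χq` are topological automorphisms (non-vacuity of the `∀ ι'`).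
[cite: MochizukiEtTh2009, §2 p.36] -/
theorem exists_continuousMulEquiv_bTwist_inversionχq_all (z : ZH) :
    ∃ ι' : PiTpχq p i j ≃ₜ* PiTpχq p i j, ∀ x,
      ι' x = (SemidirectProduct.inl (bPowGfp z) : PiTpχq p i j) * inversionχq p i j x *
        (SemidirectProduct.inl (bPowGfp z))⁻¹ :=
  ⟨(inversionχq p i j).trans
    { toMulEquiv := MulAut.conj (SemidirectProduct.inl (bPowGfp z) : PiTpχq p i j)
      continuous_toFun := by
        change Continuous fun x : PiTpχq p i j =>
          (SemidirectProduct.inl (bPowGfp z) : PiTpχq p i j) * x * (SemidirectProduct.inl (bPowGfp z))⁻¹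
        exact (continuous_const.mul continuous_id).mul continuous_const
      continuous_invFun := by
        change Continuous fun x : PiTpχq p i j =>
          (SemidirectProduct.inl (bPowGfp z) : PiTpχq p i j)⁻¹ * x * SemidirectProduct.inl (bPowGfp z)
        exact (continuous_const.mul continuous_id).mul continuous_const }, fun _ => rfl⟩

/-! ### §2. The no-go at every stage-2 model: `b`-axis lifts -/

/-- `Π^tp_Ÿ` of the stage-2 model unfolded (any even `j`): `g ∈ Π^tp_Ÿ ↔ g.left ∈ Δ^tp_{Y_2}` (`G_{K_2} = G_{ℚ_p}`).
[cite: MochizukiEtTh2009, §1 p.17] -/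
theorem mem_GtpYdd_modelχq_iff_left (hj : Even j) (g : PiTpχq p i j) :
    g ∈ (ThetaSetting.modelχq p i j hj).GtpYdd ↔ g.left ∈ dY 2 := by
  rw [GtpYdd_modelχq]
  change g ∈ (tateTwistData₀ p i j).YN 2 (fieldKN ⊥ (qModel p) 2).fixingSubgroup ↔ _
  rw [GfpTwistData₀.mem_YN, fieldKN_bot_qModel_two, IntermediateField.fixingSubgroup_bot]
  exact ⟨fun h => h.1, fun h => ⟨h, Subgroup.mem_top _⟩⟩

/-- **NO `b`-AXIS LIFT `Ad(inl b^z) ∘ ι_χq` CARRIES THE FUNCTION-LEVEL PACKAGE — every `(i, j)`, every `p`, every `z`.**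
For every theta-Kummer input `T` over `modelχq p i j hj` compatible with the genuine Kummer data `kummerDataχq` and every
`ι'` agreeing pointwise with `Ad(inl b^z) ∘ ι_χq` there is NO `ιFn` with `hιFn ∧ hΛ ∧ hιθ`: the subgroup
`{ι' x = x} ⊓ (b^Ẑ ⋊ G_{ℚ_p}) ⊓ aug⁻¹(G_{K_8})` lies in `Π^tp_Ÿ`, is `ι'`-fixed, and has Galois image `G_{K_8}`.
[cite: MochizukiEtTh2009, Prop 1.4 (ii) p.22] -/
theorem not_exists_package_modelχq_bAxisLift_of_constCompat (hj : Even j) (z : ZH)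
    (T : (ThetaSetting.modelχq p i j hj).ThetaKummerInput) (hcc : T.ConstCompat (kummerDataχq p i j hj))
    (ι' : PiTpχq p i j ≃ₜ* PiTpχq p i j)
    (hι' : ∀ x, ι' x = (SemidirectProduct.inl (bPowGfp z) : PiTpχq p i j) * inversionχq p i j x *
      (SemidirectProduct.inl (bPowGfp z))⁻¹) :
    ¬ ∃ ιFn : T.Fn →* T.Fn,
      (letI := T.instAction; ∀ (g : (ThetaSetting.modelχq p i j hj).PiTemp) (f : T.Fn),
        ιFn (g • f) = (ι' : (ThetaSetting.modelχq p i j hj).PiTemp ≃ₜ* (ThetaSetting.modelχq p i j hj).PiTemp) g •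
          ιFn f) ∧
      (∀ ζ : cyclotome T.Fn, cyclotome.map ιFn ζ = ζ) ∧ ιFn T.theta = T.const (-1) * T.theta := by
  -- the fixed points of `ι'` form a subgroup
  let Hfix : Subgroup (PiTpχq p i j) :=
    { carrier := {x | ι' x = x}
      one_mem' := map_one ι'
      mul_mem' := fun {a b} (ha : ι' a = a) (hb : ι' b = b) => show ι' (a * b) = a * b by rw [map_mul, ha, hb]
      inv_mem' := fun {a} (ha : ι' a = a) => show ι' a⁻¹ = a⁻¹ by rw [map_inv, ha] }
  let G8 : Subgroup (GQp p) := (fieldKN (⊥ : IntermediateField ℚ_[p] (PadicAlgCl p)) (qModel p) 8).fixingSubgroup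
  haveI : FiniteDimensional ℚ_[p] (fieldKN (⊥ : IntermediateField ℚ_[p] (PadicAlgCl p)) (qModel p) 8) :=
    finiteDimensional_fieldKN ⊥ (qModel p) 8
  -- the fixed-point equation on the axis
  have hfixed_iff : ∀ (t : ZH) (x : PiTpχq p i j), x.left = bPowGfp t →
      (ι' x = x ↔ t * t = kappaP p x.right ^ (-i + -i + j) * (z * (chi p x.right z)⁻¹)) := by
    intro t x hx
    constructor
    · intro h
      have hl := congrArg SemidirectProduct.left h
      rw [hι', left_bTwist_inversionχq p i j z t x hx, hx] at hl
      rw [← zh_id₁ t z, bPowGfp_injective hl]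
    · intro h
      refine SemidirectProduct.ext ?_ ?_
      · rw [hι', left_bTwist_inversionχq p i j z t x hx, hx, zh_id₂, ← h, inv_mul_cancel_left]
      · rw [hι', right_bTwist_inversionχq]
  refine (kummerCoreχq p i j hj).not_exists_package_of_constCompat_of_fixed T hcc ι'
    (H₀ := Hfix ⊓ cuspDecompχq p i j ⊓ G8.comap SemidirectProduct.rightHom) ?_ (fun x hx => hx.1.1)
    (fieldKN ⊥ (qModel p) 8) ?_
  · -- `H₀ ≤ Π^tp_Ÿ`: a fixed axis element over `σ ∈ G_{K_8}` has `t² = s⁴`, so `t = s²` is even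
    intro x hx
    obtain ⟨⟨hxfix, hxax⟩, hx8⟩ := hx
    obtain ⟨t, ht⟩ := (mem_cuspDecompχq_iff p i j x).mp hxax
    change bPowGfp t = x.left at ht
    obtain ⟨s, hs⟩ := exists_pow_four_eq_of_mem_GK8 p (-i + -i + j) z (σ := x.right) hx8
    have htt : t * t = s ^ (4 : ℕ) := by rw [hs]; exact (hfixed_iff t x ht.symm).mp hxfix
    have ht2 : t = s ^ (2 : ℕ) := by
      apply eq_of_sq_eq
      rw [pow_two, htt, ← pow_mul]
    rw [mem_GtpYdd_modelχq_iff_left p i j hj, ← ht, bPowGfp_mem_dY_iff, ht2]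
    exact level_two_sq s
  · -- Galois image `G_{K_8}`: `⊆` by definition, `⊇` by solving the fixed-point equation with `t := s²`
    ext σ
    constructor
    · rintro ⟨_, ⟨x, hx, rfl⟩, rfl⟩
      rw [(kummerCoreχq p i j hj).augTheta_toTheta]
      exact hx.2
    · intro hσ
      obtain ⟨s, hs⟩ := exists_pow_four_eq_of_mem_GK8 p (-i + -i + j) z hσ
      let x : PiTpχq p i j := ⟨bPowGfp (s ^ (2 : ℕ)), σ⟩
      have hxfix : ι' x = x := by
        refine (hfixed_iff (s ^ (2 : ℕ)) x rfl).mpr ?_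
        change s ^ (2 : ℕ) * s ^ (2 : ℕ) = kappaP p σ ^ (-i + -i + j) * (z * (chi p σ z)⁻¹)
        rw [← hs, ← pow_add]
      refine ⟨(ThetaSetting.modelχq p i j hj).toTheta x,
        ⟨x, ⟨⟨hxfix, (mem_cuspDecompχq_iff p i j x).mpr (bPowGfp_mem_bAxisGfp _)⟩, hσ⟩, rfl⟩, ?_⟩
      rw [(kummerCoreχq p i j hj).augTheta_toTheta]
      rfl

/-! ### §3. Every vertex-`0` inner lift at stage 2 -/

/-- **NO VERTEX-`0` INNER LIFT OF THE STAGE-2 INVERSION CARRIES THE FUNCTION-LEVEL PACKAGE** (every `(i, j)`, every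
`p`): for every `γ ∈ Γ` of degree `0` (`inl γ ∈ Π^tp_Y`), every `ι'` agreeing pointwise with `Ad(inl γ) ∘ ι_χq`, and every
`T` with injective `Λ(Fn) → Δ_Θ` and `ConstCompat kummerDataχq`, there is NO `ιFn` with `hιFn ∧ hΛ ∧ hιθ` — transport
(p469482 §1) along `w := inl(b^{ŷ(γ)}·γ⁻¹) ∈ Δ^tp_Ÿ` to the `b`-axis lift, then §2.
[cite: MochizukiEtTh2009, Prop 1.4 (ii) p.22] -/
theorem not_exists_package_modelχq_innerLift_of_constCompat_all (hj : Even j) (γ : Gfp)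
    (hγ : (SemidirectProduct.inl γ : PiTpχq p i j) ∈ (ThetaSetting.modelχq p i j hj).GtpY)
    (T : (ThetaSetting.modelχq p i j hj).ThetaKummerInput)
    (hinj : letI := T.instAction; Function.Injective T.coeff.hom)
    (hcc : T.ConstCompat (kummerDataχq p i j hj)) (ι' : PiTpχq p i j ≃ₜ* PiTpχq p i j)
    (hι' : ∀ x, ι' x = (SemidirectProduct.inl γ : PiTpχq p i j) * inversionχq p i j x *
      (SemidirectProduct.inl γ)⁻¹) :
    ¬ ∃ ιFn : T.Fn →* T.Fn,
      (letI := T.instAction; ∀ (g : (ThetaSetting.modelχq p i j hj).PiTemp) (f : T.Fn),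
        ιFn (g • f) = (ι' : (ThetaSetting.modelχq p i j hj).PiTemp ≃ₜ*
          (ThetaSetting.modelχq p i j hj).PiTemp) g • ιFn f) ∧
      (∀ ζ : cyclotome T.Fn, cyclotome.map ιFn ζ = ζ) ∧ ιFn T.theta = T.const (-1) * T.theta := by
  intro hP
  have hγ1 : gfpSnd γ = 1 := by
    have h := gfpSnd_left_eq_one_of_mem_gtpY_modelχq p i j hj hγ
    rwa [SemidirectProduct.left_inl] at h
  obtain ⟨ιb, hιb⟩ := exists_continuousMulEquiv_bTwist_inversionχq_all p i j (yCoordχq p i j (SemidirectProduct.inl γ))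
  have hwY : (SemidirectProduct.inl (bPowGfp (yCoordχq p i j (SemidirectProduct.inl γ))) : PiTpχq p i j) *
      (SemidirectProduct.inl γ)⁻¹ ∈ (ThetaSetting.modelχq p i j hj).GtpY :=
    mul_mem (inl_bPowGfp_mem_GtpY_modelχq p i j hj _) (inv_mem hγ)
  have hyw : yCoordχq p i j ((SemidirectProduct.inl (bPowGfp (yCoordχq p i j (SemidirectProduct.inl γ))) :
      PiTpχq p i j) * (SemidirectProduct.inl γ)⁻¹) = 1 := by
    have hê : eHat (gfpFst ((SemidirectProduct.inl γ)⁻¹ : PiTpχq p i j).left) = 1 := by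
      rw [← map_inv, SemidirectProduct.left_inl, map_inv, map_inv, eHat_gfpFst_eq_one (MonoidHom.mem_ker.mpr hγ1),
        inv_one]
    rw [yCoordχq_mul_of_eHat_eq_one p i j _ _ hê, SemidirectProduct.right_inl, map_one, MulAut.one_apply,
      yCoordχq_inl_bPowGfp, yCoordχq_inl_inv p i j hγ1, mul_inv_cancel]
  have hwYdd : (SemidirectProduct.inl (bPowGfp (yCoordχq p i j (SemidirectProduct.inl γ))) : PiTpχq p i j) *
      (SemidirectProduct.inl γ)⁻¹ ∈ (ThetaSetting.modelχq p i j hj).GtpYdd := by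
    refine mem_GtpYdd_modelχq_of_hHat_two_y p i j hj hwY ((hHat_y_eq_zero_iff 2 _).mpr ?_)
    rw [← yCoordχq_apply, hyw, map_one]
  have hwΔ : (ThetaSetting.modelχq p i j hj).aug
      ((SemidirectProduct.inl (bPowGfp (yCoordχq p i j (SemidirectProduct.inl γ))) : PiTpχq p i j) *
        (SemidirectProduct.inl γ)⁻¹) = 1 := by
    change ((SemidirectProduct.inl (bPowGfp (yCoordχq p i j (SemidirectProduct.inl γ))) : PiTpχq p i j) *
      (SemidirectProduct.inl γ)⁻¹).right = 1
    rw [SemidirectProduct.mul_right, SemidirectProduct.inv_right, SemidirectProduct.right_inl,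
      SemidirectProduct.right_inl, inv_one, mul_one]
  have hrel : ∀ x, ιb x = (SemidirectProduct.inl (bPowGfp (yCoordχq p i j (SemidirectProduct.inl γ))) :
        PiTpχq p i j) * (SemidirectProduct.inl γ)⁻¹ * ι' x *
      ((SemidirectProduct.inl (bPowGfp (yCoordχq p i j (SemidirectProduct.inl γ))) : PiTpχq p i j) *
        (SemidirectProduct.inl γ)⁻¹)⁻¹ := fun x => by
    rw [hιb, hι']
    group
  exact not_exists_package_modelχq_bAxisLift_of_constCompat p i j hj _ T hcc ιb hιb
    (T.exists_package_conj_of_exists_package hinj hwYdd hwΔ ι' ιb hrel hP)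

end Literature.AnabelianGeometry.EtaleTheta.SettingModel

end
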